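import Mathlib
import HarnessLib
import Summits.HubbardSuperconductivity.HubbardSuperconductivity.Theorems.ComplexGFFStiffnessHypACumulantHolomorphicTaylorNorm

/-!
# Crux `HypACumulant`, line `gnv` — Taylor-norm Lipschitz / parallelogram bounds from HOLOMORPHIC TAYLOR
# COEFFICIENTS (the interface through which fluctuation integrals enter)

Route `route-HubbardSuperconductivity-ComplexGFFStiffness`, cruxes stmt-HubbardSuperconductivity-19154 /
-19155, shared research statement `OnePointLipschitz`, census (C3d′) (memo §7, step S6-prep).  The bounds of
`…HolomorphicTaylorNorm` / `…HolomorphicNormsFinite` derive the holomorphy of the Taylor coefficients from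
JOINT smoothness in `(σ, φ)`; for families defined by a fluctuation integral (`R_{k+1}`, the map `S_k`) it is
more convenient to feed the coefficient holomorphy directly (it comes from `D^s ∫ = ∫ D^s`,
`QuantumFieldTheory.DerivDominated.iteratedFDeriv_integral_eq`, and dominated holomorphy,
`…HolomorphicIntegral`).  This file restates the two Taylor-norm bounds with that hypothesis:
`tayNorm_sub_le_of_holomorphic_coeff`, `tayNorm_secondDiff_le_of_holomorphic_coeff` (each `K σ` merely
`C^{r₀}`).  Pure bookkeeping; all proved, no `sorry`.

## References
* S. Adams, S. Buchholz, R. Kotecký, S. Müller, arXiv:1910.13564, Definition 13.7, (6.46)–(6.48)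
  [AdamsBuchholzKoteckyMuller2019].
-/

noncomputable section

-- `Summit.<Summit>.<Problem>`: single-conjunct summit, the duplicate component is mandated (D-0017).
set_option linter.dupNamespace false

namespace Summit.HubbardSuperconductivity.HubbardSuperconductivity.Theorems.ComplexGFF

open Metric Set Finset
open Literature.MathematicalPhysics.StatisticalMechanics.GradientRG

variable {E V : Type*} [NormedAddCommGroup E] [NormedSpace ℝ E]
  [NormedAddCommGroup V] [NormedSpace ℝ V]

/-- **Lipschitz bound of the Taylor norm from holomorphic Taylor coefficients.**  `K σ` is `C^{r₀}` (lifted)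
for each `σ`, every coefficient `σ ↦ D^s K̄_σ(Tφ)(v)`, `s ≤ r₀`, is holomorphic on the disc `|σ| < R`, and
`‖K σ‖_{T_φ} ≤ M` there: then `‖K σ − K 0‖_{T_φ} ≤ (r₀+1)·(2M/R)·|σ|`.  (The coefficient holomorphy is
what `…HolomorphicFamiliesFinite` gives for jointly smooth families and what dominated holomorphy
(`…HolomorphicIntegral`) gives for fluctuation integrals.) -/
theorem tayNorm_sub_le_of_holomorphic_coeff (T : E →ₗ[ℝ] V) (r₀ : ℕ) {K : ℂ → E → ℂ} {R M : ℝ}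
    (hKσ : ∀ σ : ℂ, ContDiff ℝ (r₀ : WithTop ℕ∞) (gaugeLift T (K σ))) (φ : E)
    (hcoefhol : ∀ s : ℕ, s ≤ r₀ → ∀ v : Fin s → LinearMap.range T,
      DifferentiableOn ℂ (fun σ => iteratedFDeriv ℝ s (gaugeLift T (K σ)) (T.rangeRestrict φ) v) (ball (0 : ℂ) R))
    (hM : ∀ σ ∈ ball (0 : ℂ) R, tayNorm T r₀ (K σ) φ ≤ M) {σ : ℂ} (hσ : σ ∈ ball (0 : ℂ) R) :
    tayNorm T r₀ (fun ψ => K σ ψ - K 0 ψ) φ ≤ ((r₀ : ℝ) + 1) * (2 * M / R) * ‖σ‖ := by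
  have hR : 0 < R := lt_of_le_of_lt (norm_nonneg σ) (mem_ball_zero_iff.mp hσ)
  have h0 : (0 : ℂ) ∈ ball (0 : ℂ) R := mem_ball_self hR
  have hM0 : 0 ≤ M := le_trans (tayNorm_nonneg T r₀ (K 0) φ) (hM 0 h0)
  set w₀ : LinearMap.range T := T.rangeRestrict φ with hw₀
  -- each Taylor coefficient: holomorphic in `σ`, bounded by `s!·M·Π‖v_i‖`, hence Lipschitz (Schwarz)
  have hcoef : ∀ s : ℕ, s ≤ r₀ → ∀ v : Fin s → LinearMap.range T,
      ‖iteratedFDeriv ℝ s (gaugeLift T (K σ)) w₀ v - iteratedFDeriv ℝ s (gaugeLift T (K 0)) w₀ v‖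
        ≤ 2 * ((s.factorial : ℝ) * M * ∏ i, ‖v i‖) / R * ‖σ‖ := by
    intro s hs v
    have hd : DifferentiableOn ℂ (fun σ' => iteratedFDeriv ℝ s (gaugeLift T (K σ')) w₀ v) (ball (0 : ℂ) R) :=
      hcoefhol s hs v
    have hb : ∀ σ' ∈ ball (0 : ℂ) R, ‖iteratedFDeriv ℝ s (gaugeLift T (K σ')) w₀ v‖ ≤ (s.factorial : ℝ) * M * ∏ i, ‖v i‖ := by
      intro σ' hσ'
      calc ‖iteratedFDeriv ℝ s (gaugeLift T (K σ')) w₀ v‖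
          ≤ ‖iteratedFDeriv ℝ s (gaugeLift T (K σ')) w₀‖ * ∏ i, ‖v i‖ := ContinuousMultilinearMap.le_opNorm _ _
        _ ≤ ((s.factorial : ℝ) * tayNorm T r₀ (K σ') φ) * ∏ i, ‖v i‖ :=
            mul_le_mul_of_nonneg_right (norm_iteratedFDeriv_gaugeLift_le_factorial_mul_tayNorm T r₀ (K σ') φ hs)
              (Finset.prod_nonneg fun i _ => norm_nonneg _)
        _ ≤ ((s.factorial : ℝ) * M) * ∏ i, ‖v i‖ :=
            mul_le_mul_of_nonneg_right (mul_le_mul_of_nonneg_left (hM σ' hσ') (Nat.cast_nonneg _))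
              (Finset.prod_nonneg fun i _ => norm_nonneg _)
    exact norm_sub_le_of_bound_ball hd hb hσ
  -- the operator norms of the coefficients of the difference
  have hop : ∀ s : ℕ, s ≤ r₀ →
      ‖iteratedFDeriv ℝ s (gaugeLift T (fun ψ => K σ ψ - K 0 ψ)) w₀‖ ≤ 2 * ((s.factorial : ℝ) * M) / R * ‖σ‖ := by
    intro s hs
    have e : gaugeLift T (fun ψ => K σ ψ - K 0 ψ) = gaugeLift T (K σ) - gaugeLift T (K 0) := rfl
    have hs' : (s : WithTop ℕ∞) ≤ (r₀ : WithTop ℕ∞) := by exact_mod_cast hs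
    rw [e, iteratedFDeriv_sub_apply ((hKσ σ).of_le hs').contDiffAt ((hKσ 0).of_le hs').contDiffAt]
    refine ContinuousMultilinearMap.opNorm_le_bound (by positivity) (fun v => ?_)
    rw [sub_apply]
    calc ‖iteratedFDeriv ℝ s (gaugeLift T (K σ)) w₀ v - iteratedFDeriv ℝ s (gaugeLift T (K 0)) w₀ v‖
        ≤ 2 * ((s.factorial : ℝ) * M * ∏ i, ‖v i‖) / R * ‖σ‖ := hcoef s hs v
      _ = 2 * ((s.factorial : ℝ) * M) / R * ‖σ‖ * ∏ i, ‖v i‖ := by ring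
  -- sum over the orders
  unfold tayNorm
  calc ∑ s ∈ Finset.range (r₀ + 1), ((s.factorial : ℝ)⁻¹) * ‖iteratedFDeriv ℝ s (gaugeLift T (fun ψ => K σ ψ - K 0 ψ)) w₀‖
      ≤ ∑ s ∈ Finset.range (r₀ + 1), (2 * M / R * ‖σ‖) := by
        refine Finset.sum_le_sum (fun s hs => ?_)
        have hs' : s ≤ r₀ := Nat.lt_succ_iff.mp (Finset.mem_range.mp hs)
        have hfac : (0 : ℝ) < s.factorial := by exact_mod_cast s.factorial_pos
        calc ((s.factorial : ℝ)⁻¹) * ‖iteratedFDeriv ℝ s (gaugeLift T (fun ψ => K σ ψ - K 0 ψ)) w₀‖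
            ≤ ((s.factorial : ℝ)⁻¹) * (2 * ((s.factorial : ℝ) * M) / R * ‖σ‖) :=
              mul_le_mul_of_nonneg_left (hop s hs') (inv_nonneg.2 hfac.le)
          _ = 2 * M / R * ‖σ‖ := by field_simp
    _ = ((r₀ : ℝ) + 1) * (2 * M / R) * ‖σ‖ := by
        rw [Finset.sum_const, Finset.card_range, nsmul_eq_mul]
        push_cast
        ring

/-- **Parallelogram bound of the Taylor norm from holomorphic Taylor coefficients** (two parameters):
`K σ τ` is `C^{r₀}` (lifted), the coefficients `D^s K̄_{σ,τ}(Tφ)(v)`, `s ≤ r₀`, are holomorphic in `σ` for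
each `τ` and in `τ` for each `σ` on the bidisc, and `‖K σ τ‖_{T_φ} ≤ M` there: then
`‖K σ τ − K σ 0 − K 0 τ + K 0 0‖_{T_φ} ≤ (r₀+1)·(4M/R²)·|σ|·|τ|`. -/
theorem tayNorm_secondDiff_le_of_holomorphic_coeff (T : E →ₗ[ℝ] V) (r₀ : ℕ) {K : ℂ → ℂ → E → ℂ} {R M : ℝ}
    (hKc : ∀ σ τ : ℂ, ContDiff ℝ (r₀ : WithTop ℕ∞) (gaugeLift T (K σ τ))) (φ : E)
    (hcoefσ : ∀ s : ℕ, s ≤ r₀ → ∀ v : Fin s → LinearMap.range T, ∀ τ ∈ ball (0 : ℂ) R,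
      DifferentiableOn ℂ (fun σ => iteratedFDeriv ℝ s (gaugeLift T (K σ τ)) (T.rangeRestrict φ) v) (ball (0 : ℂ) R))
    (hcoefτ : ∀ s : ℕ, s ≤ r₀ → ∀ v : Fin s → LinearMap.range T, ∀ σ ∈ ball (0 : ℂ) R,
      DifferentiableOn ℂ (fun τ => iteratedFDeriv ℝ s (gaugeLift T (K σ τ)) (T.rangeRestrict φ) v) (ball (0 : ℂ) R))
    (hM : ∀ σ ∈ ball (0 : ℂ) R, ∀ τ ∈ ball (0 : ℂ) R, tayNorm T r₀ (K σ τ) φ ≤ M)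
    {σ τ : ℂ} (hσ : σ ∈ ball (0 : ℂ) R) (hτ : τ ∈ ball (0 : ℂ) R) :
    tayNorm T r₀ (fun ψ => K σ τ ψ - K σ 0 ψ - K 0 τ ψ + K 0 0 ψ) φ
      ≤ ((r₀ : ℝ) + 1) * (4 * M / R ^ 2) * ‖σ‖ * ‖τ‖ := by
  have hR : 0 < R := lt_of_le_of_lt (norm_nonneg σ) (mem_ball_zero_iff.mp hσ)
  have h0 : (0 : ℂ) ∈ ball (0 : ℂ) R := mem_ball_self hR
  have hM0 : 0 ≤ M := le_trans (tayNorm_nonneg T r₀ (K 0 0) φ) (hM 0 h0 0 h0)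
  set w₀ : LinearMap.range T := T.rangeRestrict φ with hw₀
  -- coefficient-wise bound via the bidisc Schwarz estimate
  have hcoef : ∀ s : ℕ, s ≤ r₀ → ∀ v : Fin s → LinearMap.range T,
      ‖iteratedFDeriv ℝ s (gaugeLift T (K σ τ)) w₀ v - iteratedFDeriv ℝ s (gaugeLift T (K σ 0)) w₀ v
        - iteratedFDeriv ℝ s (gaugeLift T (K 0 τ)) w₀ v + iteratedFDeriv ℝ s (gaugeLift T (K 0 0)) w₀ v‖
        ≤ 4 * ((s.factorial : ℝ) * M * ∏ i, ‖v i‖) / R ^ 2 * ‖σ‖ * ‖τ‖ := by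
    intro s hs v
    set g : ℂ → ℂ → ℂ := fun σ' τ' => iteratedFDeriv ℝ s (gaugeLift T (K σ' τ')) w₀ v with hg
    have hds : ∀ τ' ∈ ball (0 : ℂ) R, DifferentiableOn ℂ (fun σ' => g σ' τ') (ball (0 : ℂ) R) :=
      fun τ' hτ' => hcoefσ s hs v τ' hτ'
    have hdt : ∀ σ' ∈ ball (0 : ℂ) R, DifferentiableOn ℂ (g σ') (ball (0 : ℂ) R) :=
      fun σ' hσ' => hcoefτ s hs v σ' hσ'
    have hb : ∀ σ' ∈ ball (0 : ℂ) R, ∀ τ' ∈ ball (0 : ℂ) R, ‖g σ' τ'‖ ≤ (s.factorial : ℝ) * M * ∏ i, ‖v i‖ := by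
      intro σ' hσ' τ' hτ'
      calc ‖iteratedFDeriv ℝ s (gaugeLift T (K σ' τ')) w₀ v‖
          ≤ ‖iteratedFDeriv ℝ s (gaugeLift T (K σ' τ')) w₀‖ * ∏ i, ‖v i‖ := ContinuousMultilinearMap.le_opNorm _ _
        _ ≤ ((s.factorial : ℝ) * tayNorm T r₀ (K σ' τ') φ) * ∏ i, ‖v i‖ :=
            mul_le_mul_of_nonneg_right (norm_iteratedFDeriv_gaugeLift_le_factorial_mul_tayNorm T r₀ (K σ' τ') φ hs)
              (Finset.prod_nonneg fun i _ => norm_nonneg _)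
        _ ≤ ((s.factorial : ℝ) * M) * ∏ i, ‖v i‖ :=
            mul_le_mul_of_nonneg_right (mul_le_mul_of_nonneg_left (hM σ' hσ' τ' hτ') (Nat.cast_nonneg _))
              (Finset.prod_nonneg fun i _ => norm_nonneg _)
    have h := norm_secondDiff_le_of_bound_bidisc hds hdt hb hσ hτ
    simpa [hg] using h
  have hop : ∀ s : ℕ, s ≤ r₀ →
      ‖iteratedFDeriv ℝ s (gaugeLift T (fun ψ => K σ τ ψ - K σ 0 ψ - K 0 τ ψ + K 0 0 ψ)) w₀‖
        ≤ 4 * ((s.factorial : ℝ) * M) / R ^ 2 * ‖σ‖ * ‖τ‖ := by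
    intro s hs
    have e : gaugeLift T (fun ψ => K σ τ ψ - K σ 0 ψ - K 0 τ ψ + K 0 0 ψ)
        = gaugeLift T (K σ τ) - gaugeLift T (K σ 0) - gaugeLift T (K 0 τ) + gaugeLift T (K 0 0) := rfl
    have hs' : (s : WithTop ℕ∞) ≤ (r₀ : WithTop ℕ∞) := by exact_mod_cast hs
    have c1 : ContDiffAt ℝ (s : WithTop ℕ∞) (gaugeLift T (K σ τ)) w₀ := ((hKc σ τ).of_le hs').contDiffAt
    have c2 : ContDiffAt ℝ (s : WithTop ℕ∞) (gaugeLift T (K σ 0)) w₀ := ((hKc σ 0).of_le hs').contDiffAt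
    have c3 : ContDiffAt ℝ (s : WithTop ℕ∞) (gaugeLift T (K 0 τ)) w₀ := ((hKc 0 τ).of_le hs').contDiffAt
    have c4 : ContDiffAt ℝ (s : WithTop ℕ∞) (gaugeLift T (K 0 0)) w₀ := ((hKc 0 0).of_le hs').contDiffAt
    have c12 : ContDiffAt ℝ (s : WithTop ℕ∞) (gaugeLift T (K σ τ) - gaugeLift T (K σ 0)) w₀ := c1.sub c2
    have c123 : ContDiffAt ℝ (s : WithTop ℕ∞) (gaugeLift T (K σ τ) - gaugeLift T (K σ 0) - gaugeLift T (K 0 τ)) w₀ :=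
      c12.sub c3
    rw [e, iteratedFDeriv_add_apply c123 c4, iteratedFDeriv_sub_apply c12 c3, iteratedFDeriv_sub_apply c1 c2]
    refine ContinuousMultilinearMap.opNorm_le_bound (by positivity) (fun v => ?_)
    simp only [add_apply, sub_apply]
    calc ‖iteratedFDeriv ℝ s (gaugeLift T (K σ τ)) w₀ v - iteratedFDeriv ℝ s (gaugeLift T (K σ 0)) w₀ v
          - iteratedFDeriv ℝ s (gaugeLift T (K 0 τ)) w₀ v + iteratedFDeriv ℝ s (gaugeLift T (K 0 0)) w₀ v‖
        ≤ 4 * ((s.factorial : ℝ) * M * ∏ i, ‖v i‖) / R ^ 2 * ‖σ‖ * ‖τ‖ := hcoef s hs v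
      _ = 4 * ((s.factorial : ℝ) * M) / R ^ 2 * ‖σ‖ * ‖τ‖ * ∏ i, ‖v i‖ := by ring
  unfold tayNorm
  calc ∑ s ∈ Finset.range (r₀ + 1), ((s.factorial : ℝ)⁻¹) *
        ‖iteratedFDeriv ℝ s (gaugeLift T (fun ψ => K σ τ ψ - K σ 0 ψ - K 0 τ ψ + K 0 0 ψ)) w₀‖
      ≤ ∑ s ∈ Finset.range (r₀ + 1), (4 * M / R ^ 2 * ‖σ‖ * ‖τ‖) := by
        refine Finset.sum_le_sum (fun s hs => ?_)
        have hs' : s ≤ r₀ := Nat.lt_succ_iff.mp (Finset.mem_range.mp hs)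
        have hfac : (0 : ℝ) < s.factorial := by exact_mod_cast s.factorial_pos
        calc ((s.factorial : ℝ)⁻¹) *
              ‖iteratedFDeriv ℝ s (gaugeLift T (fun ψ => K σ τ ψ - K σ 0 ψ - K 0 τ ψ + K 0 0 ψ)) w₀‖
            ≤ ((s.factorial : ℝ)⁻¹) * (4 * ((s.factorial : ℝ) * M) / R ^ 2 * ‖σ‖ * ‖τ‖) :=
              mul_le_mul_of_nonneg_left (hop s hs') (inv_nonneg.2 hfac.le)
          _ = 4 * M / R ^ 2 * ‖σ‖ * ‖τ‖ := by field_simp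
    _ = ((r₀ : ℝ) + 1) * (4 * M / R ^ 2) * ‖σ‖ * ‖τ‖ := by
        rw [Finset.sum_const, Finset.card_range, nsmul_eq_mul]
        push_cast
        ring

end Summit.HubbardSuperconductivity.HubbardSuperconductivity.Theorems.ComplexGFF

end
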